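import Summits.Ventures.Crystal3D.Theorems.StickyWulffConstantGenericWallFloorStackLedgerLocal
import Summits.Ventures.Crystal3D.Theorems.StickyWulffConstantGenericWallFloorDoubleStarOfFar
import Summits.Ventures.Crystal3D.Theorems.StickyWulffConstantGenericWallFloorNonChainCriterion
import HarnessLib

/-!
# Corollaries of the localised stack ledger: one-family form, `DoubleTopFar` form, irrational pairs
# (crux `GenericWallFloor`, line `WallLedgerG`)

HONEST FRAMING. Part of the venture `Summits/Ventures/Crystal3D` (cell `crystal3d-full`), helper `--supports` the
crux `GenericWallFloor` (stmt-Ventures-19480) of `route-Ventures-StickyWulffConstant`, registered line `WallLedgerG`,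
open stub `stub_twoSlabAdhesion` (general fillings).  Repackagings of `twoSlabAdhesion_stackLedger_local`
(`…StackLedgerLocal`: non-chain pairs, FULL charge, NO residual, inputs `ExactOnly` C12-55, `DoubleStarCoaxialAt`,
`CapPairCoaxial`):

* `complement_family_*` — from ONE mirror-closed family `𝓕 ∋ A₁` avoiding `A₂·Λ₀` (the hypothesis form of
  19480-p1's `general_twoSlabAdhesion_nonChain`) the complementary family `{G | G·Λ₀ ∉ 𝓕·Λ₀}` contains `A₂`,
  avoids `A₁·Λ₀` and is mirror-closed; hence **`twoSlabAdhesion_stackLedger_local'`** with exactly 19480-p1's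
  non-chain hypothesis.
* **`twoSlabAdhesion_stackLedger_local_far`** — the same with the input `DoubleTopFar` (R39d's certified
  statement, `doubleStarCoaxialAt_of_far`) in place of `∀ F₁ F₂, DoubleStarCoaxialAt F₁ F₂`: inputs
  `ExactOnly`(C12-55), `DoubleTopFar`, `CapPairCoaxial`.
* **`twoSlabAdhesion_stackLedger_local_irrational`** — every pair with ONE irrational number `√2⟪A₁cᵢ, A₂w⟫`
  (19480-p1's `rationalFrame` family; all pairs outside a countable set): the stub's inequality at full charge,
  no residual, modulo the three named inputs.

WHAT THIS IS NOT: not the stub (inputs E1 row C12-55 / R39d / R39e; chain pairs excluded); F-C1 not moved.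
-/

noncomputable section

namespace Summit.Ventures.Crystal3D.Theorems

open Summit.Ventures.Crystal3D Finset
open Literature.MathematicalPhysics.StatisticalMechanics (fccStacking contactDeficiency)
open scoped InnerProductSpace

/-! ### The complementary family -/

/-- The complementary family avoids `A₁·Λ₀` when `A₁ ∈ 𝓕`. -/
theorem complement_family_avoid (𝓕 : Set (EuclideanSpace ℝ (Fin 3) ≃ₗᵢ[ℝ] EuclideanSpace ℝ (Fin 3)))
    {A₁ : EuclideanSpace ℝ (Fin 3) ≃ₗᵢ[ℝ] EuclideanSpace ℝ (Fin 3)} (hA₁ : A₁ ∈ 𝓕) :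
    ∀ G ∈ {G : EuclideanSpace ℝ (Fin 3) ≃ₗᵢ[ℝ] EuclideanSpace ℝ (Fin 3) |
        ∀ G₁ ∈ 𝓕, G '' fccStacking 1 (Real.sqrt (2 / 3)) ≠ G₁ '' fccStacking 1 (Real.sqrt (2 / 3))},
      G '' fccStacking 1 (Real.sqrt (2 / 3)) ≠ A₁ '' fccStacking 1 (Real.sqrt (2 / 3)) :=
  fun _ hG => hG A₁ hA₁

/-- The complementary family contains `A₂` when `𝓕` avoids `A₂·Λ₀`. -/
theorem complement_family_mem (𝓕 : Set (EuclideanSpace ℝ (Fin 3) ≃ₗᵢ[ℝ] EuclideanSpace ℝ (Fin 3)))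
    {A₂ : EuclideanSpace ℝ (Fin 3) ≃ₗᵢ[ℝ] EuclideanSpace ℝ (Fin 3)}
    (havoid : ∀ G ∈ 𝓕, G '' fccStacking 1 (Real.sqrt (2 / 3)) ≠ A₂ '' fccStacking 1 (Real.sqrt (2 / 3))) :
    A₂ ∈ {G : EuclideanSpace ℝ (Fin 3) ≃ₗᵢ[ℝ] EuclideanSpace ℝ (Fin 3) |
        ∀ G₁ ∈ 𝓕, G '' fccStacking 1 (Real.sqrt (2 / 3)) ≠ G₁ '' fccStacking 1 (Real.sqrt (2 / 3))} :=
  fun G₁ hG₁ h => havoid G₁ hG₁ h.symm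

/-- The complementary family of a mirror-closed family is mirror-closed. -/
theorem complement_family_closed (𝓕 : Set (EuclideanSpace ℝ (Fin 3) ≃ₗᵢ[ℝ] EuclideanSpace ℝ (Fin 3)))
    (hclosed : ∀ G ∈ 𝓕, ∀ m : EuclideanSpace ℝ (Fin 3), ‖m‖ = 1 →
      (∀ w ∈ fccSlots, ⟪G w, m⟫_ℝ = 0 ∨ ⟪G w, m⟫_ℝ = Real.sqrt (2 / 3) ∨ ⟪G w, m⟫_ℝ = -Real.sqrt (2 / 3)) →
      ∀ G' : EuclideanSpace ℝ (Fin 3) ≃ₗᵢ[ℝ] EuclideanSpace ℝ (Fin 3),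
        (∀ x, G' x = G x - (2 * ⟪G x, m⟫_ℝ) • m) → G' ∈ 𝓕) :
    ∀ G ∈ {G : EuclideanSpace ℝ (Fin 3) ≃ₗᵢ[ℝ] EuclideanSpace ℝ (Fin 3) |
        ∀ G₁ ∈ 𝓕, G '' fccStacking 1 (Real.sqrt (2 / 3)) ≠ G₁ '' fccStacking 1 (Real.sqrt (2 / 3))},
      ∀ m : EuclideanSpace ℝ (Fin 3), ‖m‖ = 1 →
      (∀ w ∈ fccSlots, ⟪G w, m⟫_ℝ = 0 ∨ ⟪G w, m⟫_ℝ = Real.sqrt (2 / 3) ∨ ⟪G w, m⟫_ℝ = -Real.sqrt (2 / 3)) →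
      ∀ G' : EuclideanSpace ℝ (Fin 3) ≃ₗᵢ[ℝ] EuclideanSpace ℝ (Fin 3),
        (∀ x, G' x = G x - (2 * ⟪G x, m⟫_ℝ) • m) →
        G' ∈ {G : EuclideanSpace ℝ (Fin 3) ≃ₗᵢ[ℝ] EuclideanSpace ℝ (Fin 3) |
          ∀ G₁ ∈ 𝓕, G '' fccStacking 1 (Real.sqrt (2 / 3)) ≠ G₁ '' fccStacking 1 (Real.sqrt (2 / 3))} := by
  intro G hG m hm hmenu G' hG' G₁ hG₁ heq
  -- `G = R_m G′` and `m` is a menu normal of `G′`, hence of `G₁`; so `G·Λ₀ = (R_m G₁)·Λ₀` with `R_m G₁ ∈ 𝓕`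
  have hGG' : ∀ x, G x = G' x - (2 * ⟪G' x, m⟫_ℝ) • m := twin_symm G G' hm hG'
  have hmenu' : ∀ w ∈ fccSlots, ⟪G' w, m⟫_ℝ = 0 ∨ ⟪G' w, m⟫_ℝ = Real.sqrt (2 / 3) ∨ ⟪G' w, m⟫_ℝ = -Real.sqrt (2 / 3) :=
    menu_reflect G G' hm hmenu hG'
  have hmenu₁ := menu_of_image_eq G' G₁ heq hmenu'
  have h₁ : twinFrame G₁ m ∈ 𝓕 := hclosed G₁ hG₁ m hm hmenu₁ _ (fun x => twinFrame_apply G₁ hm x)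
  refine hG (twinFrame G₁ m) h₁ ?_
  have hGtw : G = twinFrame G' m := LinearIsometryEquiv.ext fun x => by rw [hGG' x, twinFrame_apply G' hm x]
  rw [hGtw, image_twinFrame_eq G' hm, image_twinFrame_eq G₁ hm, heq]

/-! ### The one-family form -/

open scoped Classical in
/-- **The localised stack ledger, one-family form** (19480-p1's non-chain hypothesis: a mirror-closed `𝓕 ∋ A₁`
avoiding `A₂·Λ₀`).  Inputs: `ExactOnly`(C12-55), `DoubleStarCoaxialAt` (all pairs), `CapPairCoaxial`. -/
theorem twoSlabAdhesion_stackLedger_local'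
    {s₀ : EuclideanSpace ℝ (Fin 3)} (hs₀ : s₀ ∈ fccSlots)
    (hcert : ExactOnly 0 (fccSlots.filter fun w => 0 < ⟪w, s₀⟫_ℝ))
    (hDS : ∀ F₁ F₂ : EuclideanSpace ℝ (Fin 3) ≃ₗᵢ[ℝ] EuclideanSpace ℝ (Fin 3), DoubleStarCoaxialAt F₁ F₂)
    (hCP : CapPairCoaxial)
    (A₁ : EuclideanSpace ℝ (Fin 3) ≃ₗᵢ[ℝ] EuclideanSpace ℝ (Fin 3)) (t₁ : EuclideanSpace ℝ (Fin 3))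
    (A₂ : EuclideanSpace ℝ (Fin 3) ≃ₗᵢ[ℝ] EuclideanSpace ℝ (Fin 3)) (t₂ : EuclideanSpace ℝ (Fin 3))
    {u₁ : EuclideanSpace ℝ (Fin 3)} (hu₁ : u₁ ∈ fccSlots)
    (hsteep₁ : Real.sqrt 2 / 2 ≤ ⟪A₁ u₁, EuclideanSpace.single (2 : Fin 3) (1 : ℝ)⟫_ℝ)
    {u₂ : EuclideanSpace ℝ (Fin 3)} (hu₂ : u₂ ∈ fccSlots)
    (hsteep₂ : ⟪A₂ u₂, EuclideanSpace.single (2 : Fin 3) (1 : ℝ)⟫_ℝ ≤ -(Real.sqrt 2 / 2))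
    (𝓕 : Set (EuclideanSpace ℝ (Fin 3) ≃ₗᵢ[ℝ] EuclideanSpace ℝ (Fin 3))) (hA₁ : A₁ ∈ 𝓕)
    (havoid : ∀ G ∈ 𝓕, G '' fccStacking 1 (Real.sqrt (2 / 3)) ≠ A₂ '' fccStacking 1 (Real.sqrt (2 / 3)))
    (hclosed : ∀ G ∈ 𝓕, ∀ m : EuclideanSpace ℝ (Fin 3), ‖m‖ = 1 →
      (∀ w ∈ fccSlots, ⟪G w, m⟫_ℝ = 0 ∨ ⟪G w, m⟫_ℝ = Real.sqrt (2 / 3) ∨ ⟪G w, m⟫_ℝ = -Real.sqrt (2 / 3)) →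
      ∀ G' : EuclideanSpace ℝ (Fin 3) ≃ₗᵢ[ℝ] EuclideanSpace ℝ (Fin 3),
        (∀ x, G' x = G x - (2 * ⟪G x, m⟫_ℝ) • m) → G' ∈ 𝓕) :
    ∃ C R₀ : ℝ, 1 ≤ R₀ ∧ ∀ h : ℝ, 0 ≤ h → ∀ ρ : ℝ, R₀ ≤ ρ →
      ∀ X P₁ P₂ : Finset (EuclideanSpace ℝ (Fin 3)),
      (∀ p ∈ X, ∀ q ∈ X, p ≠ q → 1 ≤ dist p q) → P₁ ⊆ X → P₂ ⊆ X \ P₁ →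
      (∀ p ∈ X, -(2 * R₀) ≤ p 2 ∧ p 2 ≤ h + 2 * R₀ ∧ p 0 ^ 2 + p 1 ^ 2 ≤ ρ ^ 2) →
      (∀ p, p ∈ P₁ ↔ (p ∈ (fun q => A₁ q + t₁) '' fccStacking 1 (Real.sqrt (2 / 3)) ∧
        -(2 * R₀) ≤ p 2 ∧ p 2 ≤ -R₀ ∧ p 0 ^ 2 + p 1 ^ 2 ≤ ρ ^ 2)) →
      (∀ p, p ∈ P₂ ↔ (p ∈ (fun q => A₂ q + t₂) '' fccStacking 1 (Real.sqrt (2 / 3)) ∧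
        h + R₀ ≤ p 2 ∧ p 2 ≤ h + 2 * R₀ ∧ p 0 ^ 2 + p 1 ^ 2 ≤ ρ ^ 2)) →
      ((((P₁ ×ˢ (X \ P₁)).filter fun pq => dist pq.1 pq.2 = 1).card : ℕ) : ℝ) +
        ((((P₂ ×ˢ ((X \ P₁) \ P₂)).filter fun pq => dist pq.1 pq.2 = 1).card : ℕ) : ℝ) ≤
        contactDeficiency ((X \ P₁) \ P₂) +
          (Real.sqrt 2 / 4 * ∑ᶠ w ∈ {w ∈ fccStacking 1 (Real.sqrt (2 / 3)) | ‖w‖ = 1},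
              |⟪w, A₁.symm (EuclideanSpace.single (2 : Fin 3) (1 : ℝ))⟫_ℝ| +
            Real.sqrt 2 / 4 * ∑ᶠ w ∈ {w ∈ fccStacking 1 (Real.sqrt (2 / 3)) | ‖w‖ = 1},
              |⟪w, A₂.symm (EuclideanSpace.single (2 : Fin 3) (1 : ℝ))⟫_ℝ| -
            (Real.sqrt 2 * |⟪A₁ u₁, EuclideanSpace.single (2 : Fin 3) (1 : ℝ)⟫_ℝ| +
              Real.sqrt 2 * |⟪A₂ u₂, EuclideanSpace.single (2 : Fin 3) (1 : ℝ)⟫_ℝ|) / 2) * Real.pi * ρ ^ 2 +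
          C * (1 + h) * ρ :=
  twoSlabAdhesion_stackLedger_local hs₀ hcert hDS hCP A₁ t₁ A₂ t₂ hu₁ hsteep₁ hu₂ hsteep₂ 𝓕
    {G | ∀ G₁ ∈ 𝓕, G '' fccStacking 1 (Real.sqrt (2 / 3)) ≠ G₁ '' fccStacking 1 (Real.sqrt (2 / 3))}
    hA₁ (complement_family_mem 𝓕 havoid) havoid (complement_family_avoid 𝓕 hA₁) hclosed
    (complement_family_closed 𝓕 hclosed)

/-! ### The `DoubleTopFar` form and the irrational pairs -/

open scoped Classical in
/-- **The localised stack ledger for irrational pairs, with R39d's `DoubleTopFar`.**  Inputs BY NAME: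
`ExactOnly`(C12-55) [E1], `DoubleTopFar` [R39d, certified computation], `CapPairCoaxial` [R39e].  For every pair
of moved fcc lattices with ONE irrational number `√2⟪A₁cᵢ, A₂w⟫` (`cᵢ` a cubic frame vector, `w` a slot — all
pairs outside a countable family; in particular non-chain), steep slots `u₁`/`u₂`, `R₀ = 10`, explicit `C`, in
EVERY cell of `TwoSlabAdhesion` (hypotheses verbatim): the stub's inequality at FULL charge with NO residual. -/
theorem twoSlabAdhesion_stackLedger_local_irrational
    {s₀ : EuclideanSpace ℝ (Fin 3)} (hs₀ : s₀ ∈ fccSlots)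
    (hcert : ExactOnly 0 (fccSlots.filter fun w => 0 < ⟪w, s₀⟫_ℝ))
    (hfar : DoubleTopFar) (hCP : CapPairCoaxial)
    (A₁ : EuclideanSpace ℝ (Fin 3) ≃ₗᵢ[ℝ] EuclideanSpace ℝ (Fin 3)) (t₁ : EuclideanSpace ℝ (Fin 3))
    (A₂ : EuclideanSpace ℝ (Fin 3) ≃ₗᵢ[ℝ] EuclideanSpace ℝ (Fin 3)) (t₂ : EuclideanSpace ℝ (Fin 3))
    (hirr : ∃ i : Fin 3, ∃ w ∈ fccSlots, ∀ q : ℚ, Real.sqrt 2 * ⟪A₁ (cubicFrame i), A₂ w⟫_ℝ ≠ (q : ℝ))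
    {u₁ : EuclideanSpace ℝ (Fin 3)} (hu₁ : u₁ ∈ fccSlots)
    (hsteep₁ : Real.sqrt 2 / 2 ≤ ⟪A₁ u₁, EuclideanSpace.single (2 : Fin 3) (1 : ℝ)⟫_ℝ)
    {u₂ : EuclideanSpace ℝ (Fin 3)} (hu₂ : u₂ ∈ fccSlots)
    (hsteep₂ : ⟪A₂ u₂, EuclideanSpace.single (2 : Fin 3) (1 : ℝ)⟫_ℝ ≤ -(Real.sqrt 2 / 2)) :
    ∃ C R₀ : ℝ, 1 ≤ R₀ ∧ ∀ h : ℝ, 0 ≤ h → ∀ ρ : ℝ, R₀ ≤ ρ →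
      ∀ X P₁ P₂ : Finset (EuclideanSpace ℝ (Fin 3)),
      (∀ p ∈ X, ∀ q ∈ X, p ≠ q → 1 ≤ dist p q) → P₁ ⊆ X → P₂ ⊆ X \ P₁ →
      (∀ p ∈ X, -(2 * R₀) ≤ p 2 ∧ p 2 ≤ h + 2 * R₀ ∧ p 0 ^ 2 + p 1 ^ 2 ≤ ρ ^ 2) →
      (∀ p, p ∈ P₁ ↔ (p ∈ (fun q => A₁ q + t₁) '' fccStacking 1 (Real.sqrt (2 / 3)) ∧
        -(2 * R₀) ≤ p 2 ∧ p 2 ≤ -R₀ ∧ p 0 ^ 2 + p 1 ^ 2 ≤ ρ ^ 2)) →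
      (∀ p, p ∈ P₂ ↔ (p ∈ (fun q => A₂ q + t₂) '' fccStacking 1 (Real.sqrt (2 / 3)) ∧
        h + R₀ ≤ p 2 ∧ p 2 ≤ h + 2 * R₀ ∧ p 0 ^ 2 + p 1 ^ 2 ≤ ρ ^ 2)) →
      ((((P₁ ×ˢ (X \ P₁)).filter fun pq => dist pq.1 pq.2 = 1).card : ℕ) : ℝ) +
        ((((P₂ ×ˢ ((X \ P₁) \ P₂)).filter fun pq => dist pq.1 pq.2 = 1).card : ℕ) : ℝ) ≤
        contactDeficiency ((X \ P₁) \ P₂) +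
          (Real.sqrt 2 / 4 * ∑ᶠ w ∈ {w ∈ fccStacking 1 (Real.sqrt (2 / 3)) | ‖w‖ = 1},
              |⟪w, A₁.symm (EuclideanSpace.single (2 : Fin 3) (1 : ℝ))⟫_ℝ| +
            Real.sqrt 2 / 4 * ∑ᶠ w ∈ {w ∈ fccStacking 1 (Real.sqrt (2 / 3)) | ‖w‖ = 1},
              |⟪w, A₂.symm (EuclideanSpace.single (2 : Fin 3) (1 : ℝ))⟫_ℝ| -
            (Real.sqrt 2 * |⟪A₁ u₁, EuclideanSpace.single (2 : Fin 3) (1 : ℝ)⟫_ℝ| +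
              Real.sqrt 2 * |⟪A₂ u₂, EuclideanSpace.single (2 : Fin 3) (1 : ℝ)⟫_ℝ|) / 2) * Real.pi * ρ ^ 2 +
          C * (1 + h) * ρ := by
  set 𝓕 : Set (EuclideanSpace ℝ (Fin 3) ≃ₗᵢ[ℝ] EuclideanSpace ℝ (Fin 3)) :=
    {G | ∀ i j : Fin 3, ∃ q : ℚ, ⟪A₁ (cubicFrame i), G (cubicFrame j)⟫_ℝ = (q : ℝ)} with h𝓕
  refine twoSlabAdhesion_stackLedger_local' hs₀ hcert (doubleStarCoaxialAt_of_far hfar) hCP A₁ t₁ A₂ t₂ hu₁ hsteep₁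
    hu₂ hsteep₂ 𝓕 (rationalFrame_self A₁) ?_ ?_
  · -- avoidance
    intro G hG heq
    obtain ⟨i, w, hw, hirr⟩ := hirr
    have hA₂w : A₂ w ∈ G '' fccStacking 1 (Real.sqrt (2 / 3)) := by
      rw [heq]; exact ⟨w, mem_fcc_of_mem_fccSlots hw, rfl⟩
    obtain ⟨y, hy, hyw⟩ := hA₂w
    have hy1 : ‖y‖ = 1 := by
      have := congrArg norm hyw
      rw [LinearIsometryEquiv.norm_map, LinearIsometryEquiv.norm_map, norm_eq_one_of_mem_fccSlots hw] at this
      exact this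
    obtain ⟨q, hq⟩ := rationalFrame_slot A₁ G hG i (mem_fccSlots_of_unit hy hy1)
    rw [hyw] at hq
    exact hirr q hq
  · -- closure
    intro G hG m _ hmenu G' hG'
    exact rationalFrame_mirror A₁ G G' hG hmenu hG'

end Summit.Ventures.Crystal3D.Theorems

end
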